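import Literature.Probability.LatticeModels.DobrushinShlosmanStates
import HarnessLib

/-!
# Dobrushin's comparison with an exponentially weighted received-sum condition, through cells

Third file of the cell-indexed (Dobrushin–Shlosman window) form of Dobrushin's contraction technique
(`DobrushinShlosmanComparison.lean`: abstract estimates and the single-window update;
`DobrushinShlosmanWindowDusting.lean`: the window dusting estimate `lip_windowAvg` for a general
specification; `DobrushinShlosmanStates.lean`: invariant states and covariance decay under the averaged
received-sum condition with a FINITE-RANGE profile). Here every cell is its own window (Dobrushin's
one-cell resampling, cells instead of sites) and the influence coefficients `k y x ≥ 0` (boundary cell `y`,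
resampled cell `x`) may have INFINITE RANGE: the landed profile form of the comparison theorem
(`DobrushinMetric.DustingData.abs_sub_le_sum_pow_profile`, `DobrushinShlosmanContraction.iterate_step_le`)
decays only along profiles that drop by at most one along the support of `k`, i.e. not at all when `k` is
everywhere positive, as for quasi-local (exponentially decaying, infinite-range) interactions. The remedy is
Georgii's Remark 8.26 / Künsch's weighted row-sum condition: if, besides the plain condition
`Σ_y k y x ≤ c₀ < 1` on the usable cells, a nonnegative weight `θ` with `θ ≥ 1` on the unusable cells satisfies
`Σ_y k y x θ y ≤ c₀ θ x` on the usable cells, then the iterates of the simultaneous improvement map started at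
the constant vector `R` stay below `R (c₀ⁿ + θ)`, so two invariant states differ on an admissible `F` by at
most `R Σ_x θ x δ_x(F)`; with `θ x = e^{-t d(x, Δ_g)}` this is exponential decay in the distance.

## Main results (theorems only: no definition, no named fact)

* `DobrushinShlosman.phiCells_estimate` — the simultaneous one-cell update on the usable cells of a
  nonnegative estimate is an estimate (Föllmer 1988 Ch. I Lemma (2.5), vector form, cells for sites; the
  sweep of `DobrushinMetric.DustingData.IsEstimate.phi` on top of the landed single-window update
  `DobrushinShlosman.upd_estimate`).
* `DobrushinShlosman.iterate_phiCells_le_weighted` — **the weighted contraction**: under the plain and the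
  `θ`-weighted received-sum conditions the iterates from `R` are `≤ R (c₀ⁿ + θ x)`.
* `DobrushinShlosman.abs_sub_le_sum_weighted` — the comparison estimate `|E₁ F - E₂ F| ≤ R Σ_x θ x δ x`.
* `DobrushinShlosman.abs_integral_mul_sub_le_of_weighted_influence` — **covariance decay for a general
  specification read through cells, in the TV / oscillation form**: single-cell kernels `γ_{Λ_x}`,
  `Λ_x = {v | cell v = x}`, influence coefficients `C y x` (changing the exterior on ONE cell `y ≠ x` moves the
  `γ_{Λ_x}`-expectation of an `f` reading only cell `x` with cell-oscillation `≤ δ` by `≤ C y x · δ`); for every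
  Gibbs measure `ν`, bounded measurable `f, g` reading the cells `Δf, Δg`, `θ ≥ 0` with `θ ≥ 1` on `Δg` and
  `c₀ < 1` with both received-sum conditions off `Δg`:
  `|ν(fg) - ν(f)ν(g)| ≤ 8 B_f B_g |Δg| Σ_{x ∈ Δf} θ x` (the tilt trick of `DobrushinShlosmanStates`).

## References

* H. Föllmer, *Random fields and diffusion processes*, LNM 1362 (1988), Ch. I §2: Lemma (2.5),
  Comparison Theorem (2.8), Theorem (2.13), Remark (2.17).
* H.-O. Georgii, *Gibbs Measures and Phase Transitions*, 2nd ed. (2011), Thm. 8.20, Remark 8.26, §8.2.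
* H. Künsch, Comm. Math. Phys. 84 (1982) 207–222 (decay of correlations under Dobrushin's condition).
* R. L. Dobrushin, S. B. Shlosman (1985), §2 (cells).
-/

noncomputable section

open MeasureTheory ProbabilityTheory Finset Function Filter

namespace Literature.Probability.LatticeModels.DobrushinShlosman

/-! ### The abstract layer: simultaneous one-cell updates and the weighted contraction -/

section Abstract

variable {ι Ω : Type*} [Fintype ι] [DecidableEq ι]
variable {R : ℝ} {Adm : (Ω → ℝ) → Prop} {Lip : (Ω → ℝ) → (ι → ℝ) → Prop} {T : ι → (Ω → ℝ) → (Ω → ℝ)}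
  {kc : ι → ι → ℝ} {U : Finset ι} {E₁ E₂ : (Ω → ℝ) → ℝ}

/-- **Lemma (2.5) of Föllmer, vector form, one CELL per window**: for two functionals invariant under the
usable one-cell operators, the simultaneous update `φ a` (`x ↦ Σ_y k y x a y` on the usable cells `U`, `a`
elsewhere) of a nonnegative estimate `a` is an estimate — sweep the single-window update
(`upd_estimate` with window `{x}`) over the cells, keeping the intermediate vectors below `a` by taking
minima (the device of `DobrushinMetric.DustingData.IsEstimate.phi`). [cite: Follmer1988, Ch. I Lemma (2.5)] -/
theorem phiCells_estimate (hlip0 : ∀ ⦃F : Ω → ℝ⦄ ⦃δ : ι → ℝ⦄, Lip F δ → ∀ x, 0 ≤ δ x)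
    (hk : ∀ y x, 0 ≤ kc y x) (hT : ∀ ⦃F : Ω → ℝ⦄ (c : ι), Adm F → Adm (T c F))
    (hdust : ∀ ⦃F : Ω → ℝ⦄ ⦃δ : ι → ℝ⦄ (c : ι), Adm F → Lip F δ →
      Lip (T c F) fun y => if y ∈ ({c} : Finset ι) then 0 else δ y + ∑ x ∈ ({c} : Finset ι), kc y x * δ x)
    (h₁T : ∀ ⦃F : Ω → ℝ⦄ (c : ι), c ∈ U → Adm F → E₁ (T c F) = E₁ F)
    (h₂T : ∀ ⦃F : Ω → ℝ⦄ (c : ι), c ∈ U → Adm F → E₂ (T c F) = E₂ F)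
    {phi : (ι → ℝ) → ι → ℝ} (hphi : ∀ a x, phi a x = if x ∈ U then ∑ y, kc y x * a y else a x)
    {a : ι → ℝ} (ha : ∀ ⦃F : Ω → ℝ⦄ ⦃δ : ι → ℝ⦄, Adm F → Lip F δ → |E₁ F - E₂ F| ≤ ∑ x, a x * δ x)
    (ha0 : ∀ x, 0 ≤ a x) ⦃F : Ω → ℝ⦄ ⦃δ : ι → ℝ⦄ (hF : Adm F) (hδ : Lip F δ) :
    |E₁ F - E₂ F| ≤ ∑ x, phi a x * δ x := by
  -- adapted from `DobrushinMetric.DustingData.IsEstimate.phi`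
  have sweep : ∀ s : Finset ι, ∃ b : ι → ℝ,
      (∀ ⦃F : Ω → ℝ⦄ ⦃δ : ι → ℝ⦄, Adm F → Lip F δ → |E₁ F - E₂ F| ≤ ∑ x, b x * δ x) ∧
      (∀ y, 0 ≤ b y) ∧ (∀ y, b y ≤ a y) ∧ ∀ y ∈ s, y ∈ U → b y ≤ ∑ z, kc z y * a z := by
    intro s
    induction s using Finset.induction_on with
    | empty => exact ⟨a, ha, ha0, fun _ => le_rfl, fun _ h => (Finset.notMem_empty _ h).elim⟩
    | insert x s _ ih =>
      obtain ⟨b, hb, hb0, hba, hbs⟩ := ih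
      by_cases hx : x ∈ U
      · have hupd : ∀ ⦃F : Ω → ℝ⦄ ⦃δ : ι → ℝ⦄, Adm F → Lip F δ →
            |E₁ F - E₂ F| ≤ ∑ z, (if z ∈ ({x} : Finset ι) then ∑ y, kc y z * b y else b z) * δ z :=
          fun F δ hF hδ => upd_estimate (win := fun c => ({c} : Finset ι)) (k := fun _ y z => kc y z)
            hlip0 (fun _ y z => hk y z) hT hdust h₁T h₂T hb hb0 hx hF hδ
        refine ⟨fun z => if z = x then min (b x) (∑ y, kc y x * b y) else b z, ?_, ?_, ?_, ?_⟩
        · intro F δ hF hδ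
          by_cases hmin : b x ≤ ∑ y, kc y x * b y
          · have he : (fun z => if z = x then min (b x) (∑ y, kc y x * b y) else b z) = b := by
              funext z
              by_cases hz : z = x
              · subst hz; simp [min_eq_left hmin]
              · simp [hz]
            rw [he]
            exact hb hF hδ
          · have he : (fun z => if z = x then min (b x) (∑ y, kc y x * b y) else b z) =
                fun z => if z ∈ ({x} : Finset ι) then ∑ y, kc y z * b y else b z := by
              funext z
              by_cases hz : z = x
              · subst hz; simp [min_eq_right (le_of_not_ge hmin)]
              · simp [hz]
            rw [he]
            exact hupd hF hδ
        · intro y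
          by_cases hy : y = x
          · subst hy
            simp only [if_true]
            exact le_min (hb0 _) (Finset.sum_nonneg fun z _ => mul_nonneg (hk z _) (hb0 z))
          · simp only [hy, if_false]
            exact hb0 y
        · intro y
          by_cases hy : y = x
          · subst hy
            simp only [if_true]
            exact (min_le_left _ _).trans (hba _)
          · simp only [hy, if_false]
            exact hba y
        · intro y hy hyU
          by_cases hyx : y = x
          · subst hyx
            simp only [if_true]
            exact (min_le_right _ _).trans
              (Finset.sum_le_sum fun z _ => mul_le_mul_of_nonneg_left (hba z) (hk z _))
          · simp only [hyx, if_false]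
            exact hbs y ((Finset.mem_insert.1 hy).resolve_left hyx) hyU
      · refine ⟨b, hb, hb0, hba, fun y hy hyU => ?_⟩
        rcases eq_or_ne y x with rfl | hne
        · exact (hx hyU).elim
        · exact hbs y ((Finset.mem_insert.1 hy).resolve_left hne) hyU
  obtain ⟨b, hb, -, hba, hbs⟩ := sweep Finset.univ
  refine (hb hF hδ).trans (Finset.sum_le_sum fun y _ => ?_)
  refine mul_le_mul_of_nonneg_right ?_ (hlip0 hδ y)
  rw [hphi]
  by_cases hyU : y ∈ U
  · rw [if_pos hyU]; exact hbs y (Finset.mem_univ _) hyU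
  · rw [if_neg hyU]; exact hba y

/-- The simultaneous update preserves nonnegativity. [folklore] -/
theorem phiCells_nonneg (hk : ∀ y x, 0 ≤ kc y x) {phi : (ι → ℝ) → ι → ℝ}
    (hphi : ∀ a x, phi a x = if x ∈ U then ∑ y, kc y x * a y else a x) {a : ι → ℝ}
    (ha0 : ∀ x, 0 ≤ a x) (x : ι) : 0 ≤ phi a x := by
  rw [hphi]
  split_ifs
  · exact Finset.sum_nonneg fun y _ => mul_nonneg (hk y x) (ha0 y)
  · exact ha0 x

/-- All iterates of the simultaneous update started at a nonnegative constant vector are nonnegative.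
[folklore] -/
theorem iterate_phiCells_nonneg (hk : ∀ y x, 0 ≤ kc y x) {phi : (ι → ℝ) → ι → ℝ}
    (hphi : ∀ a x, phi a x = if x ∈ U then ∑ y, kc y x * a y else a x) (hR : 0 ≤ R) (n : ℕ) (x : ι) :
    0 ≤ phi^[n] (fun _ => R) x := by
  induction n generalizing x with
  | zero => exact hR
  | succ n ih => rw [Function.iterate_succ_apply']; exact phiCells_nonneg hk hphi ih x

/-- Off the usable cells the iterates never move. [folklore] -/
theorem iterate_phiCells_of_not_mem {phi : (ι → ℝ) → ι → ℝ}
    (hphi : ∀ a x, phi a x = if x ∈ U then ∑ y, kc y x * a y else a x) (n : ℕ) {x : ι} (hx : x ∉ U) :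
    phi^[n] (fun _ => R) x = R := by
  induction n with
  | zero => rfl
  | succ n ih => rw [Function.iterate_succ_apply', hphi, if_neg hx, ih]

/-- **All iterates are estimates** (Föllmer 1988 Ch. I, "applying the lemma successively"), for two
monotone-normalised functionals invariant under the usable one-cell operators.
[cite: Follmer1988, Ch. I Comparison Theorem (2.8)] -/
theorem iterate_phiCells_estimate (hR : 0 ≤ R)
    (hlip0 : ∀ ⦃F : Ω → ℝ⦄ ⦃δ : ι → ℝ⦄, Lip F δ → ∀ x, 0 ≤ δ x)
    (hosc : ∀ ⦃F : Ω → ℝ⦄ ⦃δ : ι → ℝ⦄, Adm F → Lip F δ → ∀ σ τ, |F σ - F τ| ≤ R * ∑ x, δ x)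
    (hk : ∀ y x, 0 ≤ kc y x) (hT : ∀ ⦃F : Ω → ℝ⦄ (c : ι), Adm F → Adm (T c F))
    (hdust : ∀ ⦃F : Ω → ℝ⦄ ⦃δ : ι → ℝ⦄ (c : ι), Adm F → Lip F δ →
      Lip (T c F) fun y => if y ∈ ({c} : Finset ι) then 0 else δ y + ∑ x ∈ ({c} : Finset ι), kc y x * δ x)
    (h₁le : ∀ ⦃F : Ω → ℝ⦄ ⦃M : ℝ⦄, Adm F → (∀ σ, F σ ≤ M) → E₁ F ≤ M)
    (h₁ge : ∀ ⦃F : Ω → ℝ⦄ ⦃M : ℝ⦄, Adm F → (∀ σ, M ≤ F σ) → M ≤ E₁ F)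
    (h₁T : ∀ ⦃F : Ω → ℝ⦄ (c : ι), c ∈ U → Adm F → E₁ (T c F) = E₁ F)
    (h₂le : ∀ ⦃F : Ω → ℝ⦄ ⦃M : ℝ⦄, Adm F → (∀ σ, F σ ≤ M) → E₂ F ≤ M)
    (h₂ge : ∀ ⦃F : Ω → ℝ⦄ ⦃M : ℝ⦄, Adm F → (∀ σ, M ≤ F σ) → M ≤ E₂ F)
    (h₂T : ∀ ⦃F : Ω → ℝ⦄ (c : ι), c ∈ U → Adm F → E₂ (T c F) = E₂ F)
    {phi : (ι → ℝ) → ι → ℝ} (hphi : ∀ a x, phi a x = if x ∈ U then ∑ y, kc y x * a y else a x)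
    (n : ℕ) ⦃F : Ω → ℝ⦄ ⦃δ : ι → ℝ⦄ (hF : Adm F) (hδ : Lip F δ) :
    |E₁ F - E₂ F| ≤ ∑ x, phi^[n] (fun _ => R) x * δ x := by
  induction n generalizing F δ with
  | zero => exact const_estimate hosc h₁le h₁ge h₂le h₂ge hF hδ
  | succ n ih =>
    rw [Function.iterate_succ_apply']
    exact phiCells_estimate hlip0 hk hT hdust h₁T h₂T hphi ih (iterate_phiCells_nonneg hk hphi hR n) hF hδ

/-- **The weighted contraction** (Georgii 2011 Remark 8.26 / Künsch 1982, vector form): if on the usable cells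
the received sums are `≤ c₀ ≤ 1` and a nonnegative weight `θ`, `≥ 1` off the usable cells, satisfies the
WEIGHTED received-sum condition `Σ_y k y x θ y ≤ c₀ θ x`, then the iterates of the simultaneous update from
the constant vector `R ≥ 0` satisfy `(φⁿ R)_x ≤ R (c₀ⁿ + θ x)`. [cite: Georgii2011, Remark 8.26] -/
theorem iterate_phiCells_le_weighted (hR : 0 ≤ R) (hk : ∀ y x, 0 ≤ kc y x) {phi : (ι → ℝ) → ι → ℝ}
    (hphi : ∀ a x, phi a x = if x ∈ U then ∑ y, kc y x * a y else a x) {c₀ : ℝ} (hc0 : 0 ≤ c₀)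
    (hc1 : c₀ ≤ 1) (hrow : ∀ x ∈ U, ∑ y, kc y x ≤ c₀) {θ : ι → ℝ} (hθ0 : ∀ x, 0 ≤ θ x)
    (hθU : ∀ x, x ∉ U → 1 ≤ θ x) (hroww : ∀ x ∈ U, ∑ y, kc y x * θ y ≤ c₀ * θ x) (n : ℕ) (x : ι) :
    phi^[n] (fun _ => R) x ≤ R * (c₀ ^ n + θ x) := by
  induction n generalizing x with
  | zero =>
    simp only [Function.iterate_zero, id_eq, pow_zero]
    nlinarith [hθ0 x]
  | succ n ih =>
    by_cases hx : x ∈ U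
    · rw [Function.iterate_succ_apply', hphi, if_pos hx]
      calc ∑ y, kc y x * phi^[n] (fun _ => R) y
          ≤ ∑ y, kc y x * (R * (c₀ ^ n + θ y)) :=
            Finset.sum_le_sum fun y _ => mul_le_mul_of_nonneg_left (ih y) (hk y x)
        _ = R * (c₀ ^ n * ∑ y, kc y x + ∑ y, kc y x * θ y) := by
            rw [Finset.mul_sum, ← Finset.sum_add_distrib, Finset.mul_sum]
            exact Finset.sum_congr rfl fun y _ => by ring
        _ ≤ R * (c₀ ^ n * c₀ + c₀ * θ x) :=
            mul_le_mul_of_nonneg_left (add_le_add (mul_le_mul_of_nonneg_left (hrow x hx)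
              (pow_nonneg hc0 n)) (hroww x hx)) hR
        _ ≤ R * (c₀ ^ (n + 1) + θ x) := by
            refine mul_le_mul_of_nonneg_left ?_ hR
            rw [pow_succ]
            nlinarith [hθ0 x]
    · rw [iterate_phiCells_of_not_mem hphi (n + 1) hx]
      nlinarith [hθU x hx, pow_nonneg hc0 (n + 1)]

/-- **Dobrushin's comparison estimate under the weighted received-sum condition** (Föllmer 1988 Ch. I
Comparison Theorem (2.8) with Georgii 2011 Remark 8.26): for two monotone-normalised functionals invariant
under the usable one-cell operators, one-cell dusting data, the plain (`≤ c₀ < 1`) and the `θ`-weighted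
received-sum conditions on the usable cells and `θ ≥ 1` off them, every admissible `F` with cell-Lipschitz
vector `δ` satisfies `|E₁ F - E₂ F| ≤ R Σ_x θ x δ x`. [cite: Follmer1988, Ch. I Comparison Theorem (2.8)]
[cite: Georgii2011, Remark 8.26] -/
theorem abs_sub_le_sum_weighted (hR : 0 ≤ R)
    (hlip0 : ∀ ⦃F : Ω → ℝ⦄ ⦃δ : ι → ℝ⦄, Lip F δ → ∀ x, 0 ≤ δ x)
    (hosc : ∀ ⦃F : Ω → ℝ⦄ ⦃δ : ι → ℝ⦄, Adm F → Lip F δ → ∀ σ τ, |F σ - F τ| ≤ R * ∑ x, δ x)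
    (hk : ∀ y x, 0 ≤ kc y x) (hT : ∀ ⦃F : Ω → ℝ⦄ (c : ι), Adm F → Adm (T c F))
    (hdust : ∀ ⦃F : Ω → ℝ⦄ ⦃δ : ι → ℝ⦄ (c : ι), Adm F → Lip F δ →
      Lip (T c F) fun y => if y ∈ ({c} : Finset ι) then 0 else δ y + ∑ x ∈ ({c} : Finset ι), kc y x * δ x)
    (h₁le : ∀ ⦃F : Ω → ℝ⦄ ⦃M : ℝ⦄, Adm F → (∀ σ, F σ ≤ M) → E₁ F ≤ M)
    (h₁ge : ∀ ⦃F : Ω → ℝ⦄ ⦃M : ℝ⦄, Adm F → (∀ σ, M ≤ F σ) → M ≤ E₁ F)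
    (h₁T : ∀ ⦃F : Ω → ℝ⦄ (c : ι), c ∈ U → Adm F → E₁ (T c F) = E₁ F)
    (h₂le : ∀ ⦃F : Ω → ℝ⦄ ⦃M : ℝ⦄, Adm F → (∀ σ, F σ ≤ M) → E₂ F ≤ M)
    (h₂ge : ∀ ⦃F : Ω → ℝ⦄ ⦃M : ℝ⦄, Adm F → (∀ σ, M ≤ F σ) → M ≤ E₂ F)
    (h₂T : ∀ ⦃F : Ω → ℝ⦄ (c : ι), c ∈ U → Adm F → E₂ (T c F) = E₂ F)
    {c₀ : ℝ} (hc0 : 0 ≤ c₀) (hc1 : c₀ < 1) (hrow : ∀ x ∈ U, ∑ y, kc y x ≤ c₀) {θ : ι → ℝ}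
    (hθ0 : ∀ x, 0 ≤ θ x) (hθU : ∀ x, x ∉ U → 1 ≤ θ x) (hroww : ∀ x ∈ U, ∑ y, kc y x * θ y ≤ c₀ * θ x)
    ⦃F : Ω → ℝ⦄ ⦃δ : ι → ℝ⦄ (hF : Adm F) (hδ : Lip F δ) :
    |E₁ F - E₂ F| ≤ R * ∑ x, θ x * δ x := by
  set phi : (ι → ℝ) → ι → ℝ := fun a x => if x ∈ U then ∑ y, kc y x * a y else a x with hphidef
  have hphi : ∀ a x, phi a x = if x ∈ U then ∑ y, kc y x * a y else a x := fun _ _ => rfl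
  have hδ0 := hlip0 hδ
  -- the estimate after `n` simultaneous updates, bounded by the weighted profile
  have hB : ∀ n : ℕ, |E₁ F - E₂ F| ≤ R * c₀ ^ n * ∑ x, δ x + R * ∑ x, θ x * δ x := fun n => by
    refine (iterate_phiCells_estimate hR hlip0 hosc hk hT hdust h₁le h₁ge h₁T h₂le h₂ge h₂T hphi n
      hF hδ).trans ?_
    rw [Finset.mul_sum, Finset.mul_sum, ← Finset.sum_add_distrib]
    refine Finset.sum_le_sum fun x _ => ?_
    have h1 : phi^[n] (fun _ => R) x ≤ R * (c₀ ^ n + θ x) :=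
      iterate_phiCells_le_weighted hR hk hphi hc0 hc1.le hrow hθ0 hθU hroww n x
    have h2 : phi^[n] (fun _ => R) x * δ x ≤ R * (c₀ ^ n + θ x) * δ x :=
      mul_le_mul_of_nonneg_right h1 (hδ0 x)
    refine h2.trans (le_of_eq ?_)
    ring
  have hlim : Tendsto (fun n : ℕ => R * c₀ ^ n * ∑ x, δ x + R * ∑ x, θ x * δ x) atTop
      (nhds (R * 0 * ∑ x, δ x + R * ∑ x, θ x * δ x)) :=
    ((((tendsto_pow_atTop_nhds_zero_of_lt_one hc0 hc1).const_mul R).mul_const _).add_const _)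
  have h := ge_of_tendsto' hlim hB
  simpa using h

end Abstract

/-! ### Covariance decay for a specification read through cells, in the TV / oscillation form -/

section Cells

variable {ι V S : Type*} [MeasurableSpace S]

/-- **Covariance decay under the weighted Dobrushin condition, for a general specification read through
cells** (the tilt trick of Föllmer 1988 Ch. I Thm. (2.13) / Künsch 1982 / Georgii 2011 §8.2 on top of
`abs_sub_le_sum_weighted`; cells for sites, TV / oscillation form of the influence coefficients).
Single-CELL kernels `γ_{Λ_x}`, `Λ_x = {v | cell v = x}`; coefficients `C y x ≥ 0`: changing the exterior on one
cell `y ≠ x` moves the `γ_{Λ_x}`-expectation of every bounded measurable `f` reading only cell `x` with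
cell-oscillation `≤ δ` by at most `C y x · δ`. Then for every Gibbs measure `ν`, bounded measurable `f, g`
reading the cells `Δf, Δg`, every weight `θ ≥ 0` with `θ ≥ 1` on `Δg`, and every `c₀ < 1` bounding the plain and
the `θ`-weighted received sums off `Δg`:
`|ν(fg) - ν(f)ν(g)| ≤ 8 B_f B_g |Δg| Σ_{x ∈ Δf} θ x`. Proof: the one-cell dusting data of
`DobrushinShlosmanWindowDusting.lip_windowAvg` (window `{x}`, discrete cell weight), the two invariant states
`ν` (DLR) and its tilt by `g̃ = g - g(τ₀) + 2B_g|Δg| ≥ 0` (properness off `Δg`), the weighted comparison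
estimate with the oscillation vector `2B_f 𝟙_{Δf}`, and `cov(f,g) = ν(g̃)(ν_{g̃}(f) - ν(f))`.
[cite: Follmer1988, Ch. I Theorem (2.13)] [cite: Georgii2011, Remark 8.26 and §8.2] [cite: Kunsch1982] -/
theorem abs_integral_mul_sub_le_of_weighted_influence [Fintype ι] [DecidableEq ι] [Fintype V]
    [DecidableEq V] (cell : V → ι) {γ : Specification V S} (hγ : IsSpecification γ) {C : ι → ι → ℝ}
    (hC0 : ∀ y x, 0 ≤ C y x)
    (hC : ∀ (x y : ι), y ≠ x → ∀ (ω η : V → S), (∀ v, cell v ≠ y → ω v = η v) →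
      ∀ (f : (V → S) → ℝ) (δ : ℝ), Measurable f → (∃ B : ℝ, ∀ σ, |f σ| ≤ B) →
        DependsOn f {v | cell v = x} → 0 ≤ δ →
        (∀ σ τ : V → S, (∀ v, cell v ≠ x → σ v = τ v) → |f σ - f τ| ≤ δ) →
          |(∫ σ, f σ ∂(γ (Finset.univ.filter fun v => cell v = x) ω)) -
              ∫ σ, f σ ∂(γ (Finset.univ.filter fun v => cell v = x) η)| ≤ C y x * δ)
    {ν : Measure (V → S)} (hν : IsGibbsMeasure γ ν) {f g : (V → S) → ℝ} {Δf Δg : Finset ι} {Bf Bg : ℝ}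
    (hfm : Measurable f) (hgm : Measurable g) (hBf : ∀ σ, |f σ| ≤ Bf) (hBg : ∀ σ, |g σ| ≤ Bg)
    (hfdep : DependsOn f {v | cell v ∈ Δf}) (hgdep : DependsOn g {v | cell v ∈ Δg}) {θ : ι → ℝ} {c₀ : ℝ}
    (hθ0 : ∀ x, 0 ≤ θ x) (hθ1 : ∀ x ∈ Δg, 1 ≤ θ x) (hc0 : 0 ≤ c₀) (hc1 : c₀ < 1)
    (hrow : ∀ x, x ∉ Δg → ∑ y, C y x ≤ c₀) (hroww : ∀ x, x ∉ Δg → ∑ y, C y x * θ y ≤ c₀ * θ x) :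
    |∫ σ, f σ * g σ ∂ν - (∫ σ, f σ ∂ν) * ∫ σ, g σ ∂ν| ≤ 8 * Bf * Bg * Δg.card * ∑ x ∈ Δf, θ x := by
  classical
  -- adapted from `DobrushinShlosman.abs_covariance_le` (finite-range profile form)
  haveI := hν.isProbabilityMeasure
  obtain ⟨τ₀, -⟩ := nonempty_of_measure_ne_zero (μ := ν) (s := Set.univ) (by simp)
  have hBf0 : 0 ≤ Bf := (abs_nonneg _).trans (hBf τ₀)
  have hBg0 : 0 ≤ Bg := (abs_nonneg _).trans (hBg τ₀)
  -- the discrete cell weight and the one-cell windows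
  set w : ι → (V → S) → (V → S) → ℝ := fun x σ τ => if (∀ v, cell v = x → σ v = τ v) then 0 else 1
    with hwdef
  have hw01 : ∀ x σ τ, w x σ τ = 0 ∨ w x σ τ = 1 := fun x σ τ => by
    simp only [hwdef]; split_ifs <;> simp
  have hwR : ∀ x σ τ, w x σ τ ≤ 1 := fun x σ τ => by
    rcases hw01 x σ τ with h | h <;> rw [h]; norm_num
  have hw0 : ∀ x σ τ, 0 ≤ w x σ τ := fun x σ τ => by
    rcases hw01 x σ τ with h | h <;> rw [h]; norm_num
  have hwloc : ∀ (c : ι) (σ σ' τ τ' : V → S), (∀ v, cell v = c → σ v = σ' v) →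
      (∀ v, cell v = c → τ v = τ' v) → w c σ τ = w c σ' τ' := by
    intro c σ σ' τ τ' hσ hτ
    have hiff : (∀ v, cell v = c → σ v = τ v) ↔ (∀ v, cell v = c → σ' v = τ' v) :=
      ⟨fun h v hv => by rw [← hσ v hv, ← hτ v hv]; exact h v hv,
        fun h v hv => by rw [hσ v hv, hτ v hv]; exact h v hv⟩
    simp only [hwdef, hiff]
  -- a weight-zero pair agreeing off the cell is equal
  have heq_of_w : ∀ (x : ι) (σ τ : V → S), (∀ v, cell v ≠ x → σ v = τ v) → w x σ τ = 0 → σ = τ := by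
    intro x σ τ hoff hw
    have hon : ∀ v, cell v = x → σ v = τ v := by
      by_contra hcon
      simp only [hwdef, if_neg hcon] at hw
      exact one_ne_zero hw
    funext v
    by_cases hv : cell v = x
    · exact hon v hv
    · exact hoff v hv
  set Λ : ι → Finset V := fun x => Finset.univ.filter fun v => cell v = x with hΛdef
  have hΛ : ∀ c v, v ∈ Λ c ↔ cell v ∈ ({c} : Finset ι) := fun c v => by
    simp [hΛdef]
  -- the contraction hypothesis in the window form consumed by `lip_windowAvg`
  have hcontract : ∀ (c y : ι), y ∉ ({c} : Finset ι) → ∀ (ω η : V → S),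
      (∀ v, cell v ≠ y → ω v = η v) →
      ∀ (F : (V → S) → ℝ) (δ : ι → ℝ), Measurable F → (∃ B, ∀ σ, |F σ| ≤ B) →
        DependsOn F {v | cell v ∈ ({c} : Finset ι)} → (∀ x, 0 ≤ δ x) →
        (∀ (x : ι) (σ τ : V → S), (∀ v, cell v ≠ x → σ v = τ v) → |F σ - F τ| ≤ δ x * w x σ τ) →
          |∫ σ, F σ ∂(γ (Λ c) ω) - ∫ σ, F σ ∂(γ (Λ c) η)| ≤
            (∑ x ∈ ({c} : Finset ι), C y x * δ x) * w y ω η := by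
    intro c y hy ω η hωη F δ hFm hFb hFdep hδ0 hFlip
    rw [Finset.sum_singleton]
    have hyc : y ≠ c := fun h => hy (Finset.mem_singleton.2 h)
    rcases hw01 y ω η with h0 | h1
    · have e := heq_of_w y ω η hωη h0
      subst e
      rw [sub_self, abs_zero]
      exact mul_nonneg (mul_nonneg (hC0 _ _) (hδ0 c)) (hw0 _ _ _)
    · rw [h1, mul_one]
      have hdep' : DependsOn F {v | cell v = c} := by
        have : {v | cell v ∈ ({c} : Finset ι)} = {v | cell v = c} := by
          ext v; simp
        rwa [this] at hFdep
      refine hC c y hyc ω η hωη F (δ c) hFm hFb hdep' (hδ0 c) fun σ τ hστ => ?_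
      exact (hFlip c σ τ hστ).trans (mul_le_of_le_one_right (hδ0 c) (hwR c σ τ))
  -- cutting bounds down to the cells an observable reads: oscillation vectors `2B 𝟙_Δ`
  have lipOf : ∀ {F : (V → S) → ℝ} {B : ℝ} {Δ : Finset ι}, (∀ σ, |F σ| ≤ B) →
      DependsOn F {v | cell v ∈ Δ} → ∀ (x : ι) (σ τ : V → S), (∀ v, cell v ≠ x → σ v = τ v) →
        |F σ - F τ| ≤ (if x ∈ Δ then 2 * B else 0) * w x σ τ := by
    intro F B Δ hB hdep x σ τ hστ
    have hB0 : 0 ≤ B := (abs_nonneg _).trans (hB τ)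
    rcases hw01 x σ τ with h0 | h1
    · have e := heq_of_w x σ τ hστ h0
      subst e
      rw [sub_self, abs_zero]
      exact mul_nonneg (by split_ifs <;> nlinarith) (hw0 _ _ _)
    rw [h1, mul_one]
    split_ifs with hx
    · calc |F σ - F τ| ≤ |F σ| + |F τ| := abs_sub _ _
        _ ≤ B + B := add_le_add (hB σ) (hB τ)
        _ = 2 * B := by ring
    · rw [hdep fun v (hv : cell v ∈ Δ) => hστ v fun hvx => hx (hvx ▸ hv), sub_self, abs_zero]
  have lip0Of : ∀ {B : ℝ} {Δ : Finset ι}, 0 ≤ B → ∀ x : ι, 0 ≤ (if x ∈ Δ then 2 * B else 0) :=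
    fun hB x => by split_ifs <;> nlinarith
  -- the shifted density `g̃ ∈ [0, 2 S_g]`, `S_g = 2 B_g |Δg|`
  set Sg : ℝ := 1 * ∑ y, (if y ∈ Δg then 2 * Bg else 0) with hSg
  have hSgval : Sg = 2 * Bg * Δg.card := by
    rw [hSg, one_mul, Finset.sum_ite_mem, Finset.univ_inter, Finset.sum_const, nsmul_eq_mul]; ring
  have hSg0 : 0 ≤ Sg := by rw [hSgval]; positivity
  have hosc : ∀ σ, |g σ - g τ₀| ≤ Sg := fun σ =>
    abs_sub_le_sum_cells hwR (lip0Of hBg0) (lipOf hBg hgdep) σ τ₀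
  set gt : (V → S) → ℝ := fun σ => g σ + (Sg - g τ₀) with hgt
  have hgt0 : ∀ σ, 0 ≤ gt σ := fun σ => by
    have := (abs_le.1 (hosc σ)).1; simp only [hgt]; linarith
  have hgtB : ∀ σ, gt σ ≤ 2 * Sg := fun σ => by
    have := (abs_le.1 (hosc σ)).2; simp only [hgt]; linarith
  have hgtm : Measurable gt := hgm.add_const _
  have hgtdep : DependsOn gt {v | cell v ∈ Δg} := fun σ τ h => by
    simp only [hgt]; rw [hgdep h]
  have hgi : Integrable g ν := DobrushinMetric.integrable_of_abs_le' hgm hBg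
  have hgtabs : ∀ σ, |gt σ| ≤ 2 * Sg := fun σ => by
    rw [abs_of_nonneg (hgt0 σ)]; exact hgtB σ
  have hgti : Integrable gt ν := DobrushinMetric.integrable_of_abs_le' hgtm hgtabs
  -- the right-hand side is nonnegative
  have hRHS : 0 ≤ 8 * Bf * Bg * Δg.card * ∑ x ∈ Δf, θ x := by
    have := Finset.sum_nonneg fun x (_ : x ∈ Δf) => hθ0 x
    positivity
  -- `ν(fg) - ν(f)ν(g) = cov(f, g) = cov(f, g̃) = ν(f g̃) - ν(f) ν(g̃)`
  have hcov0 : ∫ σ, f σ * g σ ∂ν - (∫ σ, f σ ∂ν) * ∫ σ, g σ ∂ν = cov[f, g; ν] := by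
    rw [covariance_eq_sub]
    · rfl
    · exact memLp_of_bounded (a := -Bf) (b := Bf)
        (ae_of_all _ fun σ => abs_le.1 (hBf σ)) hfm.aestronglyMeasurable 2
    · exact memLp_of_bounded (a := -Bg) (b := Bg)
        (ae_of_all _ fun σ => abs_le.1 (hBg σ)) hgm.aestronglyMeasurable 2
  have hcov : cov[f, g; ν] = ∫ σ, f σ * gt σ ∂ν - (∫ σ, f σ ∂ν) * ∫ σ, gt σ ∂ν := by
    have h1 : cov[f, g; ν] = cov[f, gt; ν] := by
      rw [hgt, covariance_add_const_right hgi]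
    rw [h1, covariance_eq_sub]
    · rfl
    · exact memLp_of_bounded (a := -Bf) (b := Bf)
        (ae_of_all _ fun σ => abs_le.1 (hBf σ)) hfm.aestronglyMeasurable 2
    · exact memLp_of_bounded (a := -(2 * Sg)) (b := 2 * Sg)
        (ae_of_all _ fun σ => abs_le.1 (hgtabs σ)) hgtm.aestronglyMeasurable 2
  rw [hcov0]
  by_cases hz : ∫ σ, gt σ ∂ν = 0
  · -- degenerate case: `g̃ = 0` a.e., so the covariance vanishes
    have hae : gt =ᵐ[ν] 0 := (integral_eq_zero_iff_of_nonneg (fun σ => hgt0 σ) hgti).1 hz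
    have hfg : ∫ σ, f σ * gt σ ∂ν = 0 := by
      rw [← integral_zero (α := V → S) (μ := ν) (G := ℝ)]
      refine integral_congr_ae ?_
      filter_upwards [hae] with σ hσ
      simp [hσ]
    rw [hcov, hfg, hz, mul_zero, sub_zero, abs_zero]
    exact hRHS
  have hpos : 0 < ∫ σ, gt σ ∂ν := lt_of_le_of_ne (integral_nonneg hgt0) (Ne.symm hz)
  -- the one-cell dusting data: bounded measurable observables, cell-Lipschitz bounds, `T c = γ_{Λ c}`
  set Adm : ((V → S) → ℝ) → Prop := fun F => Measurable F ∧ ∃ B, ∀ σ, |F σ| ≤ B with hAdm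
  set Lip : ((V → S) → ℝ) → (ι → ℝ) → Prop := fun F δ => (∀ x, 0 ≤ δ x) ∧
    ∀ (x : ι) (σ τ : V → S), (∀ v, cell v ≠ x → σ v = τ v) → |F σ - F τ| ≤ δ x * w x σ τ with hLip
  set T : ι → ((V → S) → ℝ) → ((V → S) → ℝ) := fun c F η => ∫ σ, F σ ∂(γ (Λ c) η) with hT
  have hlip0 : ∀ ⦃F : (V → S) → ℝ⦄ ⦃δ : ι → ℝ⦄, Lip F δ → ∀ x, 0 ≤ δ x := fun F δ h => h.1
  have hoscA : ∀ ⦃F : (V → S) → ℝ⦄ ⦃δ : ι → ℝ⦄, Adm F → Lip F δ →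
      ∀ σ τ, |F σ - F τ| ≤ 1 * ∑ x, δ x :=
    fun F δ _ h => abs_sub_le_sum_cells hwR h.1 h.2
  have hTA : ∀ ⦃F : (V → S) → ℝ⦄ (c : ι), Adm F → Adm (T c F) := fun F c h =>
    ⟨measurable_windowAvg' hγ (Λ c) h.1, h.2.imp fun B hB η => abs_windowAvg_le' hγ (Λ c) hB η⟩
  have hdust : ∀ ⦃F : (V → S) → ℝ⦄ ⦃δ : ι → ℝ⦄ (c : ι), Adm F → Lip F δ →
      Lip (T c F) fun y => if y ∈ ({c} : Finset ι) then 0 else δ y +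
        ∑ x ∈ ({c} : Finset ι), C y x * δ x := by
    intro F δ c hF hδ
    obtain ⟨hFm, B, hB⟩ := hF
    refine ⟨fun y => ?_, fun y ω η hωη =>
      lip_windowAvg hγ hwloc (hΛ c) (hcontract c) hFm hB hδ.1 hδ.2 y ω η hωη⟩
    dsimp only
    split_ifs
    · exact le_rfl
    · exact add_nonneg (hδ.1 y) (Finset.sum_nonneg fun x _ => mul_nonneg (hC0 y x) (hδ.1 x))
  -- the two invariant states: `ν` and its tilt by `g̃`, usable cells = cells off `Δg`
  set U : Finset ι := Finset.univ.filter fun c => c ∉ Δg with hUdef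
  have hUiff : ∀ c, c ∈ U ↔ c ∉ Δg := fun c => by simp [hUdef]
  set E₁ : ((V → S) → ℝ) → ℝ := fun F => ∫ σ, F σ ∂ν with hE₁
  set E₂ : ((V → S) → ℝ) → ℝ := fun F => (∫ σ, gt σ * F σ ∂ν) / ∫ σ, gt σ ∂ν with hE₂
  have h₁le : ∀ ⦃F : (V → S) → ℝ⦄ ⦃M : ℝ⦄, Adm F → (∀ σ, F σ ≤ M) → E₁ F ≤ M := by
    rintro F M ⟨hFm, B, hB⟩ hM
    calc ∫ σ, F σ ∂ν ≤ ∫ _σ, M ∂ν :=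
          integral_mono (DobrushinMetric.integrable_of_abs_le' hFm hB) (integrable_const M) hM
      _ = M := by simp
  have h₁ge : ∀ ⦃F : (V → S) → ℝ⦄ ⦃M : ℝ⦄, Adm F → (∀ σ, M ≤ F σ) → M ≤ E₁ F := by
    rintro F M ⟨hFm, B, hB⟩ hM
    calc M = ∫ _σ, M ∂ν := by simp
      _ ≤ ∫ σ, F σ ∂ν :=
          integral_mono (integrable_const M) (DobrushinMetric.integrable_of_abs_le' hFm hB) hM
  have h₁T : ∀ ⦃F : (V → S) → ℝ⦄ (c : ι), c ∈ U → Adm F → E₁ (T c F) = E₁ F := by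
    rintro F c - ⟨hFm, B, hB⟩
    exact hν.integral_integral_eq hγ (Λ c) (DobrushinMetric.integrable_of_abs_le' hFm hB)
  have hgfi : ∀ {F : (V → S) → ℝ}, Measurable F → ∀ {B : ℝ}, (∀ σ, |F σ| ≤ B) →
      Integrable (fun σ => gt σ * F σ) ν := fun hFm B hB =>
    hgti.mul_bdd hFm.aestronglyMeasurable (ae_of_all _ fun σ => by rw [Real.norm_eq_abs]; exact hB σ)
  have h₂le : ∀ ⦃F : (V → S) → ℝ⦄ ⦃M : ℝ⦄, Adm F → (∀ σ, F σ ≤ M) → E₂ F ≤ M := by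
    rintro F M ⟨hFm, B, hB⟩ hM
    change (∫ σ, gt σ * F σ ∂ν) / ∫ σ, gt σ ∂ν ≤ M
    rw [div_le_iff₀ hpos]
    calc ∫ σ, gt σ * F σ ∂ν ≤ ∫ σ, gt σ * M ∂ν :=
          integral_mono (hgfi hFm hB) (hgti.mul_const M) fun σ =>
            mul_le_mul_of_nonneg_left (hM σ) (hgt0 σ)
      _ = M * ∫ σ, gt σ ∂ν := by rw [integral_mul_const, mul_comm]
  have h₂ge : ∀ ⦃F : (V → S) → ℝ⦄ ⦃M : ℝ⦄, Adm F → (∀ σ, M ≤ F σ) → M ≤ E₂ F := by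
    rintro F M ⟨hFm, B, hB⟩ hM
    change M ≤ (∫ σ, gt σ * F σ ∂ν) / ∫ σ, gt σ ∂ν
    rw [le_div_iff₀ hpos]
    calc M * ∫ σ, gt σ ∂ν = ∫ σ, gt σ * M ∂ν := by rw [integral_mul_const, mul_comm]
      _ ≤ ∫ σ, gt σ * F σ ∂ν :=
          integral_mono (hgti.mul_const M) (hgfi hFm hB) fun σ =>
            mul_le_mul_of_nonneg_left (hM σ) (hgt0 σ)
  have h₂T : ∀ ⦃F : (V → S) → ℝ⦄ (c : ι), c ∈ U → Adm F → E₂ (T c F) = E₂ F := by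
    rintro F c hc ⟨hFm, B, hB⟩
    change (∫ η, gt η * (∫ σ, F σ ∂(γ (Λ c) η)) ∂ν) / ∫ σ, gt σ ∂ν =
      (∫ σ, gt σ * F σ ∂ν) / ∫ σ, gt σ ∂ν
    congr 1
    have hW : ∀ z ∈ ({c} : Finset ι), z ∉ Δg := fun z hz => by
      rw [Finset.mem_singleton.1 hz]; exact (hUiff c).1 hc
    simp_rw [mul_windowAvg_eq_of_dependsOn hγ (hΛ c) hgtdep hW]
    exact hν.integral_integral_eq hγ (Λ c) (hgfi hFm hB)
  -- the received-sum conditions on the usable cells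
  have hrowU : ∀ x ∈ U, ∑ y, C y x ≤ c₀ := fun x hx => hrow x ((hUiff x).1 hx)
  have hrowwU : ∀ x ∈ U, ∑ y, C y x * θ y ≤ c₀ * θ x := fun x hx => hroww x ((hUiff x).1 hx)
  have hθU : ∀ x, x ∉ U → 1 ≤ θ x := fun x hx => hθ1 x (by simpa [hUiff] using hx)
  -- the weighted comparison theorem for `f` with the oscillation vector `2 B_f 𝟙_{Δf}`
  have key := abs_sub_le_sum_weighted (kc := C) (U := U) (E₁ := E₁) (E₂ := E₂) zero_le_one hlip0 hoscA
    hC0 hTA hdust h₁le h₁ge h₁T h₂le h₂ge h₂T hc0 hc1 hrowU hθ0 hθU hrowwU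
    (F := f) (δ := fun x => if x ∈ Δf then 2 * Bf else 0) ⟨hfm, Bf, hBf⟩ ⟨lip0Of hBf0, lipOf hBf hfdep⟩
  have hsum : ∑ x, θ x * (if x ∈ Δf then 2 * Bf else 0) = 2 * Bf * ∑ x ∈ Δf, θ x := by
    rw [Finset.mul_sum, ← Finset.sum_filter_add_sum_filter_not Finset.univ (fun x => x ∈ Δf)]
    have h1 : ∑ x ∈ Finset.univ.filter (fun x => x ∈ Δf), θ x * (if x ∈ Δf then 2 * Bf else 0) =
        ∑ x ∈ Δf, 2 * Bf * θ x := by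
      have : Finset.univ.filter (fun x => x ∈ Δf) = Δf := by ext x; simp
      rw [this]
      exact Finset.sum_congr rfl fun x hx => by rw [if_pos hx]; ring
    have h2 : ∑ x ∈ Finset.univ.filter (fun x => ¬x ∈ Δf), θ x * (if x ∈ Δf then 2 * Bf else 0) = 0 :=
      Finset.sum_eq_zero fun x hx => by rw [if_neg (Finset.mem_filter.1 hx).2, mul_zero]
    rw [h1, h2, add_zero]
  rw [one_mul, hsum] at key
  change |∫ σ, f σ ∂ν - (∫ σ, gt σ * f σ ∂ν) / ∫ σ, gt σ ∂ν| ≤ 2 * Bf * ∑ x ∈ Δf, θ x at key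
  -- `cov = ν(g̃) · (ν_{g̃}(f) - ν(f))`
  have hfgt : ∫ σ, f σ * gt σ ∂ν = ∫ σ, gt σ * f σ ∂ν :=
    integral_congr_ae (ae_of_all _ fun σ => mul_comm _ _)
  have hident : cov[f, g; ν] =
      (∫ σ, gt σ ∂ν) * ((∫ σ, gt σ * f σ ∂ν) / ∫ σ, gt σ ∂ν - ∫ σ, f σ ∂ν) := by
    rw [hcov, hfgt, mul_sub, mul_div_cancel₀ _ hz]
    ring
  rw [hident, abs_mul, abs_of_pos hpos, abs_sub_comm]
  have hgtint : ∫ σ, gt σ ∂ν ≤ 2 * Sg := by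
    calc ∫ σ, gt σ ∂ν ≤ ∫ _σ, 2 * Sg ∂ν := integral_mono hgti (integrable_const _) hgtB
      _ = 2 * Sg := by simp
  have hθs : 0 ≤ ∑ x ∈ Δf, θ x := Finset.sum_nonneg fun x _ => hθ0 x
  calc (∫ σ, gt σ ∂ν) * |∫ σ, f σ ∂ν - (∫ σ, gt σ * f σ ∂ν) / ∫ σ, gt σ ∂ν|
      ≤ (2 * Sg) * (2 * Bf * ∑ x ∈ Δf, θ x) :=
        mul_le_mul hgtint key (abs_nonneg _) (by positivity)
    _ = 8 * Bf * Bg * Δg.card * ∑ x ∈ Δf, θ x := by rw [hSgval]; ring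

end Cells

end Literature.Probability.LatticeModels.DobrushinShlosman

end
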